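import Mathlib.Algebra.Order.Ring.Abs
import Mathlib.Algebra.Order.Field.Basic
import Mathlib.Data.Real.Basic
import Mathlib.Tactic.Linarith
import Mathlib.Tactic.Positivity
import Mathlib.Tactic.NormNum
import Mathlib.Tactic.Ring

/-!
# Crux `CubicForrelation.NearExactIsExact` (stmt-QuantumAdvantage-14043), stub `stub_dyadicPin`

Line `direct-sum-amplification`, stub DP (`stub_dyadicPin`, elementary): a DYADIC real number
(`0` or `±2^t`, `t : ℕ`) lying within LESS than `2^s / 2` of a plateau value `x = ±2^s` equals it.
In the low-rank-dyadic-rigidity step of the line this pins an entry of a derivative Walsh table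
(known to be dyadic) to the plateau value it is close to.

Proof.  From `x² = 4^s = (2^s)²` we get `|x| = 2^s` (`dp_abs_eq`).  If `y = 0` then
`|y − x| = 2^s < 2^s/2` is absurd.  If `y² = 4^t` then `|y| = 2^t` and
`|2^t − 2^s| = ||y| − |x|| ≤ |y − x| < 2^s/2`; for `t < s` the left side is `≥ 2^s − 2^s/2`, for
`s < t` it is `≥ 2^{s+1} − 2^s = 2^s`, so `t = s` and `|y| = |x|`.  Finally `y = −x` would give
`|y − x| = 2·2^s`, so `y = x`.  Mathlib only; no named facts.
-/

set_option linter.dupNamespace false -- D-0017: single-problem summit ⇒ `QuantumAdvantage.QuantumAdvantage` by design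

namespace Summit.QuantumAdvantage.QuantumAdvantage.Theorems.CubicForrelation.NearExactIsExact

/-- `x² = 4^s` forces `|x| = 2^s`. -/
theorem dp_abs_eq {x : ℝ} {s : ℕ} (h : x ^ 2 = (4 : ℝ) ^ s) : |x| = (2 : ℝ) ^ s := by
  have h4 : (4 : ℝ) ^ s = ((2 : ℝ) ^ s) ^ 2 := by
    rw [← pow_mul, mul_comm, pow_mul]
    norm_num
  have habs := (sq_eq_sq_iff_abs_eq_abs x ((2 : ℝ) ^ s)).mp (h.trans h4)
  rwa [abs_of_pos (by positivity : (0 : ℝ) < (2 : ℝ) ^ s)] at habs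

/-- **stub_dyadicPin** (DP). A dyadic value within less than half of `±2^s` IS `±2^s`:
`x² = 4^s`, `y ∈ {0} ∪ {±2^t}`, `|y − x| < 2^s/2 ⇒ y = x`. -/
theorem stub_dyadicPin :
    ∀ (x y : ℝ) (s : ℕ), x ^ 2 = (4 : ℝ) ^ s → (y = 0 ∨ ∃ t : ℕ, y ^ 2 = (4 : ℝ) ^ t) →
      |y - x| < (2 : ℝ) ^ s / 2 → y = x := by
  intro x y s hx hy hlt
  have hxa : |x| = (2 : ℝ) ^ s := dp_abs_eq hx
  have hpos : (0 : ℝ) < (2 : ℝ) ^ s := by positivity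
  rcases hy with rfl | ⟨t, ht⟩
  · rw [zero_sub, abs_neg, hxa] at hlt
    linarith
  · have hya : |y| = (2 : ℝ) ^ t := dp_abs_eq ht
    have hts : t = s := by
      have key : |(2 : ℝ) ^ t - (2 : ℝ) ^ s| < (2 : ℝ) ^ s / 2 :=
        calc |(2 : ℝ) ^ t - (2 : ℝ) ^ s| = |(|y| - |x|)| := by rw [hxa, hya]
          _ ≤ |y - x| := abs_abs_sub_abs_le_abs_sub y x
          _ < (2 : ℝ) ^ s / 2 := hlt
      rcases lt_trichotomy t s with h | h | h
      · exfalso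
        have h1 : (2 : ℝ) ^ (t + 1) ≤ (2 : ℝ) ^ s := pow_le_pow_right₀ (by norm_num) h
        rw [pow_succ] at h1
        have h2 : (2 : ℝ) ^ s - (2 : ℝ) ^ t ≤ |(2 : ℝ) ^ t - (2 : ℝ) ^ s| := by
          rw [abs_sub_comm]
          exact le_abs_self _
        linarith
      · exact h
      · exfalso
        have h1 : (2 : ℝ) ^ (s + 1) ≤ (2 : ℝ) ^ t := pow_le_pow_right₀ (by norm_num) h
        rw [pow_succ] at h1
        have h2 : (2 : ℝ) ^ t - (2 : ℝ) ^ s ≤ |(2 : ℝ) ^ t - (2 : ℝ) ^ s| := le_abs_self _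
        linarith
    subst hts
    rw [← hxa] at hya
    rcases abs_eq_abs.mp hya with h | h
    · exact h
    · exfalso
      rw [h, show -x - x = -(2 * x) by ring, abs_neg, abs_mul, abs_two, hxa] at hlt
      linarith

end Summit.QuantumAdvantage.QuantumAdvantage.Theorems.CubicForrelation.NearExactIsExact
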